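import Mathlib
import Literature.NumberTheory.NumberFields.IdealNormEquationSupportPin
import HarnessLib

/-!
# The Frobenius co-ideal on the `w`-block modulo `q = p^r`: `𝔠·ē ≡ (p^{r-1})·ē (mod q)` (the two arithmetic rows of the `w`-block congruence relation)

Topic `Literature/NumberTheory/NumberFields`, namespace `Literature.NumberTheory.NumberFields`.  THEOREMS ONLY (no `def`, no instance, no named fact),
Mathlib + ★ `IdealNormEquationSupportPin` (the `Associates.count` currency `ord_v`).

## Source (read at the page) and what is recorded

G. Shimura, *Abelian Varieties with Complex Multiplication and Modular Functions* (1998), §13.1 Theorem 1 (pp. 97–99): the Frobenius ideal of a CM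
reduction at `𝔭_w` has `w`-part `𝔭_w^{e_w f_w}`; J. S. Milne, *Algebraic Number Theory* (v3.00), Thm. 3.7 (p. 42), Rem. 3.12 ∕ Cor. 3.13 (p. 43) (unique
factorisation; `𝔞 ⊆ 𝔭^n ↔ ord_𝔭 𝔞 ≥ n`; `𝔞 + 𝔟 = gcd`).  What is formalised is the elementary congruence used by the `w`-block section of the congruence relation
(cell `hodgecm-mathlib`, W-DOCK ED. 3 `WBlockLaw.rlw_shift` ∕ `rL_W`, hypotheses `h𝔠₁` ∕ `h𝔠₂` VERBATIM with the idempotent abstracted to `ē`): in a Dedekind domain `O`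
with a nonzero prime `𝔭_w ∋ p` UNRAMIFIED in the sense `(p) = 𝔭_w · 𝔟`, an element `ē ∈ 𝔟^r` (the CRT idempotent of the `w`-factor of `O ∕ p^r`) and an ideal `𝔠` of exact
`w`-exponent `r − 1` (the Frobenius co-ideal `𝔞_γ 𝔭_w⁻¹`, `ord_w 𝔞_γ = r = f_w`):
* `exists_mul_eq_pow_pred_mul_of_mem` — (h𝔠₁) every `a ∈ 𝔠` has `a·ē = p^{r−1}·b + p^r·c₁` (indeed with `c₁ = 0`: `aē ∈ (𝔭_w 𝔟)^{r−1} = (p^{r−1})`);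
* `exists_mem_pow_pred_mul_eq` — (h𝔠₂) some `a ∈ 𝔠` has `p^{r−1}·ē = a·b + p^r·c₂` (`p^{r−1} ∈ 𝔭_w^{r−1} = 𝔠 + 𝔭_w^r`, and `𝔭_w^r·ē ⊆ (p^r)`);
* the same two rows from the COUNT currency of ★ p847749 ∕ the L3 closer `stub_ROOF0` (`ord_w 𝔠 = r − 1`: `…_of_count_eq`; and `ord_w 𝔠 = ord_w 𝔞 − 1` from
  `𝔠 · 𝔭_w = 𝔞`: `count_eq_count_sub_one_of_mul_asIdeal_eq`).
No coprimality of `𝔟` and `𝔭_w` and no congruence `ē ≡ 1 (𝔭_w)` is needed for these two rows; unramifiedness IS needed for (h𝔠₂).  §4 (ED. 2, append-only):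
the CONJUGATE-block row — `𝔠 ⊔ 𝔭_u = ⊤`, `(p) = 𝔭_u·𝔟′`, `ε ∈ 𝔟′^r` ⇒ `ε = a·b + p^r·c` with `a ∈ 𝔠` («`𝔠` is a unit on the `u`-block»), also from `𝔠·𝔭_w = 𝔞`, `𝔞 ⊔ 𝔭_u = ⊤`.
`--supports stmt-HodgeConjecture-24832`, count-neutral.

## Mathlib / tree search

Mathlib: `Ideal.mem_span_singleton'`, `Ideal.span_singleton_pow`, `Ideal.mul_mem_mul`, `Ideal.pow_le_pow_right`, `Ideal.irreducible_pow_sup`,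
`Ideal.count_associates_factors_eq`, `Submodule.mem_sup`; tree ★ `IdealNormEquationSupportPin` (`pow_dvd_iff_le_count`, `count_span_natCast_pow`), ★
`TorsionLayerBlockIdempotents` ∕ `BlockIdempotentFamily` (the producers of `ē` with `a r ∈ 𝔟^r`; not imported). No existing statement of the two rows (`rg "p \\^ \\(r - 1\\)" Literature` = W-dock only).
-/

namespace Literature.NumberTheory.NumberFields

open IsDedekindDomain

variable {O : Type*} [CommRing O] [IsDedekindDomain O]

/-! ### §1 The two rows from ideal-theoretic hypotheses -/

omit [IsDedekindDomain O] in
/-- **(h𝔠₁) `a·ē ∈ (p^{r−1})` for `a ∈ 𝔠 ⊆ 𝔭_w^{r−1}` and `ē ∈ 𝔟^r`, `(p) = 𝔭_w·𝔟`** — in the W-dock token shape `a * ē = p^{r-1} * b + p^r * c₁` (with `c₁ = 0`).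
[cite: Shimura1998, §13.1 Thm. 1 (pp. 97–99)] [cite: MilneANT2008, Rem. 3.12 (p. 43)] -/
theorem exists_mul_eq_pow_pred_mul_of_mem {w 𝔟 𝔠 : Ideal O} {p r : ℕ} {e : O}
    (hp : Ideal.span {(p : O)} = w * 𝔟) (he : e ∈ 𝔟 ^ r) (h𝔠 : 𝔠 ≤ w ^ (r - 1)) (a : O) (ha : a ∈ 𝔠) :
    ∃ b c₁ : O, a * e = (p ^ (r - 1) : ℕ) * b + (p ^ r : ℕ) * c₁ := by
  have hmem : a * e ∈ Ideal.span {((p ^ (r - 1) : ℕ) : O)} := by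
    rw [Nat.cast_pow, ← Ideal.span_singleton_pow, hp, mul_pow]
    exact Ideal.mul_mem_mul (h𝔠 ha) (Ideal.pow_le_pow_right (Nat.sub_le r 1) he)
  obtain ⟨b, hb⟩ := Ideal.mem_span_singleton'.1 hmem
  exact ⟨b, 0, by rw [mul_zero, add_zero, ← hb, mul_comm]⟩

omit [IsDedekindDomain O] in
/-- **(h𝔠₂) `p^{r−1}·ē ∈ 𝔠 + (p^r)` when `𝔭_w^{r−1} ⊆ 𝔠 + 𝔭_w^r`, `ē ∈ 𝔟^r`, `(p) = 𝔭_w·𝔟`** — in the W-dock token shape `p^{r-1} * ē = a * b + p^r * c₂` with `a ∈ 𝔠`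
(and `b = ē`): write `p^{r−1} = a + π` with `a ∈ 𝔠`, `π ∈ 𝔭_w^r`; then `π·ē ∈ 𝔭_w^r 𝔟^r = (p^r)`. [cite: Shimura1998, §13.1 Thm. 1 (pp. 97–99)] [cite: MilneANT2008, Rem. 3.12 (p. 43)] -/
theorem exists_mem_pow_pred_mul_eq {w 𝔟 𝔠 : Ideal O} {p r : ℕ} {e : O}
    (hp : Ideal.span {(p : O)} = w * 𝔟) (he : e ∈ 𝔟 ^ r) (h𝔠 : w ^ (r - 1) ≤ 𝔠 ⊔ w ^ r) :
    ∃ a ∈ 𝔠, ∃ b c₂ : O, ((p ^ (r - 1) : ℕ) : O) * e = a * b + (p ^ r : ℕ) * c₂ := by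
  -- `p ∈ 𝔭_w`, so `p^{r-1} ∈ 𝔭_w^{r-1} ⊆ 𝔠 + 𝔭_w^r`
  have hpw : (p : O) ∈ w := by
    have : (p : O) ∈ Ideal.span {(p : O)} := Ideal.mem_span_singleton_self _
    rw [hp] at this
    exact Ideal.mul_le_right this
  have hpr : ((p ^ (r - 1) : ℕ) : O) ∈ 𝔠 ⊔ w ^ r := by
    rw [Nat.cast_pow]
    exact h𝔠 (Ideal.pow_mem_pow hpw _)
  obtain ⟨a, ha, π, hπ, hsum⟩ := Submodule.mem_sup.1 hpr
  -- `π ē ∈ 𝔭_w^r 𝔟^r = (p^r)`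
  have hπe : π * e ∈ Ideal.span {((p ^ r : ℕ) : O)} := by
    rw [Nat.cast_pow, ← Ideal.span_singleton_pow, hp, mul_pow]
    exact Ideal.mul_mem_mul hπ he
  obtain ⟨c₂, hc₂⟩ := Ideal.mem_span_singleton'.1 hπe
  refine ⟨a, ha, e, c₂, ?_⟩
  rw [← hsum, add_mul, ← hc₂, mul_comm c₂]

/-! ### §2 The same rows from the exponent `ord_w 𝔠 = r − 1` (the count currency of ★ `IdealNormEquationSupportPin`) -/

/-- `ord_w 𝔠 = r − 1` (`𝔠 ≠ 0`) gives `𝔠 ⊆ 𝔭_w^{r−1}`. [cite: MilneANT2008, Rem. 3.12 (p. 43)] -/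
theorem le_pow_of_count_eq (w : HeightOneSpectrum O) {𝔠 : Ideal O} (h𝔠 : 𝔠 ≠ ⊥) {n : ℕ}
    (hn : (Associates.mk w.asIdeal).count (Associates.mk 𝔠).factors = n) : 𝔠 ≤ w.asIdeal ^ n :=
  Ideal.le_of_dvd ((pow_dvd_iff_le_count w h𝔠 n).2 hn.ge)

/-- `ord_w 𝔠 = r − 1` (`𝔠 ≠ 0`) gives `𝔭_w^{r−1} ⊆ 𝔠 + 𝔭_w^r` (indeed `𝔠 + 𝔭_w^r = 𝔭_w^{min(r−1, r)} = 𝔭_w^{r−1}`, Mathlib `Ideal.irreducible_pow_sup`).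
[cite: MilneANT2008, Thm. 3.7 (p. 42), Rem. 3.12 (p. 43)] -/
theorem pow_pred_le_sup_pow_of_count_eq (w : HeightOneSpectrum O) {𝔠 : Ideal O} (h𝔠 : 𝔠 ≠ ⊥) {r : ℕ}
    (hr : (Associates.mk w.asIdeal).count (Associates.mk 𝔠).factors = r - 1) : w.asIdeal ^ (r - 1) ≤ 𝔠 ⊔ w.asIdeal ^ r := by
  classical
  rw [sup_comm, Ideal.irreducible_pow_sup h𝔠 w.irreducible, ← Ideal.count_associates_factors_eq h𝔠 w.isPrime w.ne_bot, hr]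
  exact Ideal.pow_le_pow_right (min_le_left _ _)

/-- **(h𝔠₁) from the exponent**: `(p) = 𝔭_w·𝔟`, `ē ∈ 𝔟^r`, `ord_w 𝔠 = r − 1` ⇒ every `a ∈ 𝔠` has `a·ē = p^{r−1}·b + p^r·c₁`.
[cite: Shimura1998, §13.1 Thm. 1 (pp. 97–99)] -/
theorem exists_mul_eq_pow_pred_mul_of_count_eq (w : HeightOneSpectrum O) {𝔟 𝔠 : Ideal O} {p r : ℕ} {e : O}
    (hp : Ideal.span {(p : O)} = w.asIdeal * 𝔟) (he : e ∈ 𝔟 ^ r) (h𝔠 : 𝔠 ≠ ⊥)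
    (hr : (Associates.mk w.asIdeal).count (Associates.mk 𝔠).factors = r - 1) (a : O) (ha : a ∈ 𝔠) :
    ∃ b c₁ : O, a * e = (p ^ (r - 1) : ℕ) * b + (p ^ r : ℕ) * c₁ :=
  exists_mul_eq_pow_pred_mul_of_mem hp he (le_pow_of_count_eq w h𝔠 hr) a ha

/-- **(h𝔠₂) from the exponent**: `(p) = 𝔭_w·𝔟`, `ē ∈ 𝔟^r`, `ord_w 𝔠 = r − 1` ⇒ some `a ∈ 𝔠` has `p^{r−1}·ē = a·b + p^r·c₂`.
[cite: Shimura1998, §13.1 Thm. 1 (pp. 97–99)] -/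
theorem exists_mem_pow_pred_mul_eq_of_count_eq (w : HeightOneSpectrum O) {𝔟 𝔠 : Ideal O} {p r : ℕ} {e : O}
    (hp : Ideal.span {(p : O)} = w.asIdeal * 𝔟) (he : e ∈ 𝔟 ^ r) (h𝔠 : 𝔠 ≠ ⊥)
    (hr : (Associates.mk w.asIdeal).count (Associates.mk 𝔠).factors = r - 1) :
    ∃ a ∈ 𝔠, ∃ b c₂ : O, ((p ^ (r - 1) : ℕ) : O) * e = a * b + (p ^ r : ℕ) * c₂ :=
  exists_mem_pow_pred_mul_eq hp he (pow_pred_le_sup_pow_of_count_eq w h𝔠 hr)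

/-! ### §3 The exponent of the co-ideal from the twist ideal: `𝔠 · 𝔭_w = 𝔞` ⇒ `ord_w 𝔠 = ord_w 𝔞 − 1` -/

/-- **`ord_w 𝔠 = ord_w 𝔞 − 1` when `𝔠 · 𝔭_w = 𝔞 ≠ 0`** (exponents add under products). [cite: MilneANT2008, Thm. 3.7 (p. 42)] -/
theorem count_eq_count_sub_one_of_mul_asIdeal_eq (w : HeightOneSpectrum O) {𝔞 𝔠 : Ideal O} (h𝔞 : 𝔞 ≠ ⊥) (h : 𝔠 * w.asIdeal = 𝔞) :
    (Associates.mk w.asIdeal).count (Associates.mk 𝔠).factors = (Associates.mk w.asIdeal).count (Associates.mk 𝔞).factors - 1 := by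
  have h𝔠 : 𝔠 ≠ ⊥ := by
    rintro rfl
    exact h𝔞 (by rw [← h, Submodule.bot_mul])
  rw [← h, ← Associates.mk_mul_mk, Associates.count_mul (Associates.mk_ne_zero.2 h𝔠) (Associates.mk_ne_zero.2 w.ne_bot) w.associates_irreducible,
    Associates.count_self w.associates_irreducible, Nat.add_sub_cancel]

/-- **THE TWO ROWS FROM WHAT THE L3 CLOSER HOLDS**: `(p) = 𝔭_w·𝔟` with `ord_w (p) = 1` (unramified `w`; `p ≠ 0` in `O`), `ē ∈ 𝔟^r`, `𝔠·𝔭_w = 𝔞` and `ord_w 𝔞 = ord_w (p^r)` (★ p847992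
`count_eq_count_span_of_sup_complexConj_smul_eq_top` at `n = p^r`) ⇒ (h𝔠₁) ∧ (h𝔠₂). [cite: Shimura1998, §13.1 Thm. 1 (pp. 97–99)] -/
theorem frobCoideal_block_rows (w : HeightOneSpectrum O) {𝔟 𝔞 𝔠 : Ideal O} {p r : ℕ} {e : O} (hp0 : (p : O) ≠ 0)
    (hp : Ideal.span {(p : O)} = w.asIdeal * 𝔟) (hw1 : (Associates.mk w.asIdeal).count (Associates.mk (Ideal.span {(p : O)})).factors = 1)
    (he : e ∈ 𝔟 ^ r) (h𝔞 : 𝔞 ≠ ⊥) (h𝔠𝔞 : 𝔠 * w.asIdeal = 𝔞)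
    (hord : (Associates.mk w.asIdeal).count (Associates.mk 𝔞).factors =
      (Associates.mk w.asIdeal).count (Associates.mk (Ideal.span {((p ^ r : ℕ) : O)})).factors) :
    (∀ a ∈ 𝔠, ∃ b c₁ : O, a * e = (p ^ (r - 1) : ℕ) * b + (p ^ r : ℕ) * c₁) ∧
      ∃ a ∈ 𝔠, ∃ b c₂ : O, ((p ^ (r - 1) : ℕ) : O) * e = a * b + (p ^ r : ℕ) * c₂ := by
  have h𝔠 : 𝔠 ≠ ⊥ := by
    rintro rfl
    exact h𝔞 (by rw [← h𝔠𝔞, Submodule.bot_mul])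
  have hr : (Associates.mk w.asIdeal).count (Associates.mk 𝔠).factors = r - 1 := by
    rw [count_eq_count_sub_one_of_mul_asIdeal_eq w h𝔞 h𝔠𝔞, hord, Nat.cast_pow, ← Ideal.span_singleton_pow, Associates.mk_pow,
      Associates.count_pow (Associates.mk_ne_zero.2 ((Ideal.span_singleton_eq_bot.not).2 hp0)) w.associates_irreducible,
      hw1, mul_one]
  exact ⟨exists_mul_eq_pow_pred_mul_of_count_eq w hp he h𝔠 hr, exists_mem_pow_pred_mul_eq_of_count_eq w hp he h𝔠 hr⟩

/-! ### §4 (ED. 2, append-only) The CONJUGATE block: a co-ideal prime to `𝔭_u` is a unit on the `u`-factor of `O ∕ p^r` -/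

omit [IsDedekindDomain O] in
/-- **`𝔠 ⊔ 𝔭_u = ⊤`, `(p) = 𝔭_u·𝔟′`, `ε ∈ 𝔟′^r` ⇒ `ε = a·b + p^r·c` with `a ∈ 𝔠`** («`𝔠` acts as a unit on the `u`-block of the `p^r`-torsion»: the `c•w`-block
counterpart of (h𝔠₂), where `ε` is the CRT idempotent of the `u`-factor; `𝔟′^r = 𝔟′^r·(𝔠 + 𝔭_u^r) ⊆ 𝔠 + (p^r)`).  In the W-dock token shape with `b = 1`.
[cite: Shimura1998, §13.1 Thm. 1 (pp. 97–99)] [cite: MilneANT2008, Rem. 3.12 (p. 43)] -/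
theorem exists_mem_eq_mul_add_pow_mul_of_sup_eq_top {u 𝔟 𝔠 : Ideal O} {p r : ℕ} {e : O}
    (hp : Ideal.span {(p : O)} = u * 𝔟) (he : e ∈ 𝔟 ^ r) (h𝔠 : 𝔠 ⊔ u = ⊤) :
    ∃ a ∈ 𝔠, ∃ b c : O, e = a * b + (p ^ r : ℕ) * c := by
  have hle : 𝔟 ^ r ≤ 𝔠 ⊔ Ideal.span {((p ^ r : ℕ) : O)} := by
    rw [Nat.cast_pow, ← Ideal.span_singleton_pow, hp, mul_pow]
    calc 𝔟 ^ r = 𝔟 ^ r * (𝔠 ⊔ u ^ r) := by rw [Ideal.sup_pow_eq_top h𝔠, Ideal.mul_top]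
      _ = 𝔟 ^ r * 𝔠 ⊔ u ^ r * 𝔟 ^ r := by rw [Ideal.mul_sup, mul_comm (u ^ r)]
      _ ≤ 𝔠 ⊔ u ^ r * 𝔟 ^ r := sup_le_sup_right Ideal.mul_le_left _
  obtain ⟨a, ha, x, hx, hsum⟩ := Submodule.mem_sup.1 (hle he)
  obtain ⟨c, hc⟩ := Ideal.mem_span_singleton'.1 hx
  exact ⟨a, ha, 1, c, by rw [mul_one, ← hsum, ← hc, mul_comm c]⟩

omit [IsDedekindDomain O] in
/-- The same from the L3 closer՚s data: `𝔠 · 𝔭_w = 𝔞` and `𝔞 ⊔ 𝔭_u = ⊤` (the row `(π1)` at `u = c•w`) give `𝔠 ⊔ 𝔭_u = ⊤`, hence the unit row on the `u`-block.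
[cite: Shimura1998, §13.1 Thm. 1 (pp. 97–99)] -/
theorem exists_mem_eq_mul_add_pow_mul_of_mul_eq_of_sup_eq_top {u w 𝔟 𝔞 𝔠 : Ideal O} {p r : ℕ} {e : O}
    (hp : Ideal.span {(p : O)} = u * 𝔟) (he : e ∈ 𝔟 ^ r) (h𝔠𝔞 : 𝔠 * w = 𝔞) (h𝔞 : 𝔞 ⊔ u = ⊤) :
    ∃ a ∈ 𝔠, ∃ b c : O, e = a * b + (p ^ r : ℕ) * c :=
  exists_mem_eq_mul_add_pow_mul_of_sup_eq_top hp he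
    (top_le_iff.1 (h𝔞 ▸ sup_le_sup_right (h𝔠𝔞 ▸ Ideal.mul_le_right : 𝔞 ≤ 𝔠) u))

end Literature.NumberTheory.NumberFields
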